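import Literature.AlgebraicGeometry.Frobenioids.ArchimedeanAutActionWitness
import Literature.AlgebraicGeometry.Frobenioids.ArchimedeanIstrProofs
import Literature.AlgebraicGeometry.Frobenioids.ArchimedeanBaseComparison
import HarnessLib

/-!
# Frobenioids II, Theorem 3.6 (v), the bracket "`O^×(A)` … isomorphic to `S¹`" — PROVED for `C = C^ℤ`

Mochizuki, *The geometry of Frobenioids II*, Kyushu J. Math. **62** (2008) 401–460, §3, Theorem 3.6 (v),
author's kurims text p. 37 [cite: MochizukiFrdII2008, Thm 3.6 (v) p.37]: "(v) Let `A ∈ Ob(F)`. … it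
[`O^×(A)`] has infinitely many torsion elements [and is in fact isomorphic to `S¹`] if and only if
`Λ = ℤ` and `A` is complex isotropic."

This file DISCHARGES the clause `ArchFrd.Thm36v_isoCircle` of `ArchimedeanBasicProperties.lean` for the
archimedean Frobenioid `C = C₀ ×_{D₀} D` of Example 3.3 over any base `π : D → D₀`
(`AngularFrobenioidsRelative.lean`, seat abc-iut-L1-t6; the case `Λ = ℤ`, structure `C.toElem π`, base
comparison `π ⋙ D0.toArchBase`): for a complex isotropic object `X`, the group `O^×(X)` of base-identity
linear automorphisms is `{(id, 1, c) : |c| = 1} ≅ S¹` (Mathlib's `Circle`). Ingredients: an element of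
`O^×(X)` lies over the identity of `D`, hence its `C₀`-component has base the identity, degree `1` and a
scalar `c` with `c · A_X ⊆ A_X`; evaluating at the point `tip(X) ∈ A_X` gives `|c| ≤ 1`, and the same for
the inverse gives `|c| = 1`; conversely every `c ∈ S¹` acts on the isotropic region (`C0.unitScalarAut`,
`ArchimedeanAutActionWitness.lean`). No statement of the paper is strengthened.
-/

namespace Literature.AlgebraicGeometry.Frobenioids

open CategoryTheory
open scoped Pointwise

universe v u

namespace ArchFrd

/-- An object of `D₀` mapping to a complex object is complex (there is no arrow `Spec ℝ → Spec ℂ` in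
`D₀`). [cite: MochizukiFrdII2008, §3 p.23] -/
theorem D0.isComplex_of_hom {K L : D0} (f : K ⟶ L) (hL : L.IsComplex) : K.IsComplex := by
  unfold D0.IsComplex at *
  subst hL
  cases K
  · exact (D0.isEmpty_hom_real_complex.false f).elim
  · rfl

variable {D : Type u} [Category.{v} D] (π : D ⥤ D0)

/-- The automorphism `((id, 1, c), id)` of an object of `C` with naively isotropic complex
`C₀`-component, for `c ∈ ℂ^×` of absolute value `1`. [cite: MochizukiFrdII2008, Thm 3.6 (v) p.37] -/
noncomputable def unitAutOver (X : C π) (hX : X.fst.IsNaivelyIsotropic) (hc : X.fst.IsComplexObj)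
    (c : ℂˣ) (hn : ‖(c : ℂ)‖ = 1) : X ≅ X :=
  CFP.isoMk (C0.unitScalarAut X.fst hX hc c hn) (Iso.refl X.snd) (by
    change 𝟙 _ ≫ X.iso.hom = X.iso.hom ≫ π.map (𝟙 X.snd)
    rw [CategoryTheory.Functor.map_id, Category.id_comp, Category.comp_id])

/-- `unitAutOver c ∈ O^×(X)`. [cite: MochizukiFrdII2008, Thm 3.6 (v) p.37] -/
theorem unitAutOver_mem (X : C π) (hX : X.fst.IsNaivelyIsotropic) (hc : X.fst.IsComplexObj)
    (c : ℂˣ) (hn : ‖(c : ℂ)‖ = 1) :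
    unitAutOver π X hX hc c hn ∈ PreFrobenioid.unitsSubgroup (C.toElem π) X :=
  ⟨rfl, rfl⟩

/-- `‖toUnits z‖ = 1` for `z ∈ S¹`. [cite: MochizukiFrdII2008, Thm 3.6 (v) p.37] -/
theorem norm_coe_circle_toUnits (z : Circle) : ‖((Circle.toUnits z : ℂˣ) : ℂ)‖ = 1 := by
  rw [Circle.toUnits_apply, Units.val_mk0]
  exact z.norm_coe

/-- The homomorphism `S¹ → Aut(X)`, `z ↦ ((id, 1, z), id)`. [cite: MochizukiFrdII2008, Thm 3.6 (v) p.37] -/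
noncomputable def circleToAut (X : C π) (hX : X.fst.IsNaivelyIsotropic) (hc : X.fst.IsComplexObj) :
    Circle →* Aut X where
  toFun z := unitAutOver π X hX hc (Circle.toUnits z) (norm_coe_circle_toUnits z)
  map_one' := by
    apply Iso.ext
    refine CFP.hom_ext (C0.hom_ext rfl rfl ?_) rfl
    change Circle.toUnits 1 = 1
    exact map_one _
  map_mul' z w := by
    apply Iso.ext
    change (unitAutOver π X hX hc _ _).hom =
      (unitAutOver π X hX hc _ _).hom ≫ (unitAutOver π X hX hc _ _).hom
    refine CFP.hom_ext (C0.hom_ext ?_ ?_ ?_) ?_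
    · exact (Category.comp_id _).symm
    · exact (mul_one _).symm
    · rw [CFP.comp_fst, C0.scalar_comp']
      change Circle.toUnits (z * w) =
        D0.Hom.act (𝟙 X.fst.base) (Circle.toUnits z) * Circle.toUnits w ^ ((1 : ℕ+) : ℕ)
      unfold D0.Hom.act
      rw [D0.twists_id, D0.galAct_false, PNat.one_coe, pow_one, map_mul]
    · exact (Category.comp_id _).symm

/-- The scalar of the `C₀`-component of an element of `O^×(X)` has absolute value at most `1` when `X`
has naively isotropic `C₀`-component (evaluate `c · A_X ⊆ A_X` at the point `tip(X)`).
[cite: MochizukiFrdII2008, Thm 3.6 (v) p.37] -/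
theorem norm_scalar_le_one_of_mem_unitsSubgroup (X : C π) (hX : X.fst.IsNaivelyIsotropic)
    (u : Aut X) (hu : u ∈ PreFrobenioid.unitsSubgroup (C.toElem π) X) :
    ‖((C0.scalar u.hom.fst : ℂˣ) : ℂ)‖ ≤ 1 := by
  obtain ⟨hb, hd⟩ := hu
  have hsnd : u.hom.snd = 𝟙 X.snd := hb
  have hdeg : C0.degFr u.hom.fst = 1 := hd
  have hbase : C0.Base u.hom.fst = 𝟙 X.fst.base := by
    have hw := u.hom.w
    rw [hsnd, CategoryTheory.Functor.map_id, Category.comp_id] at hw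
    exact (cancel_mono X.iso.hom).mp (hw.trans (Category.id_comp _).symm)
  -- the point `tip(X)` of the (isotropic) region
  have hmem : ofPosReal ℂ X.fst.region.tip ∈ X.fst.region.carrier := by
    rw [C0.mem_carrier_of_isIsotropic hX, absHom_ofPosReal]
  have h2 := (C0.Hom.mapsTo u.hom.fst) (Set.smul_mem_smul_set (a := C0.scalar u.hom.fst)
    (Set.pow_mem_pow hmem (n := (C0.degFr u.hom.fst : ℕ))))
  rw [hdeg, PNat.one_coe, pow_one] at h2
  change _ ∈ C0.pullRegion X.fst (C0.Base u.hom.fst) at h2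
  rw [hbase, C0.pullRegion_id, C0.mem_carrier_of_isIsotropic hX, ← Subtype.coe_le_coe, coe_absHom,
    smul_eq_mul, Units.val_mul, norm_mul, coe_ofPosReal, RCLike.norm_ofReal,
    abs_of_pos X.fst.region.tip.2] at h2
  -- h2 : ‖c‖ * tip ≤ tip
  by_contra hlt
  rw [not_le] at hlt
  have : (X.fst.region.tip : ℝ) < ‖((C0.scalar u.hom.fst : ℂˣ) : ℂ)‖ * X.fst.region.tip :=
    lt_mul_left X.fst.region.tip.2 hlt
  exact absurd h2 (not_le.mpr this)

/-- … hence has absolute value exactly `1` (apply the bound to `u` and to `u⁻¹`, whose scalars multiply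
to `1`). [cite: MochizukiFrdII2008, Thm 3.6 (v) p.37] -/
theorem norm_scalar_eq_one_of_mem_unitsSubgroup (X : C π) (hX : X.fst.IsNaivelyIsotropic)
    (u : Aut X) (hu : u ∈ PreFrobenioid.unitsSubgroup (C.toElem π) X) :
    ‖((C0.scalar u.hom.fst : ℂˣ) : ℂ)‖ = 1 := by
  have h1 := norm_scalar_le_one_of_mem_unitsSubgroup π X hX u hu
  have h2 := norm_scalar_le_one_of_mem_unitsSubgroup π X hX u⁻¹ (inv_mem hu)
  change ‖((C0.scalar u.inv.fst : ℂˣ) : ℂ)‖ ≤ 1 at h2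
  -- scalars of `u.inv ≫ u.hom = 𝟙` multiply to `1`
  obtain ⟨hb', hd'⟩ := inv_mem hu
  have hsnd' : u.inv.snd = 𝟙 X.snd := hb'
  have hbase' : C0.Base u.inv.fst = 𝟙 X.fst.base := by
    have hw := u.inv.w
    rw [hsnd', CategoryTheory.Functor.map_id, Category.comp_id] at hw
    exact (cancel_mono X.iso.hom).mp (hw.trans (Category.id_comp _).symm)
  have hdeg : C0.degFr u.hom.fst = 1 := hu.2
  have hprod : C0.scalar u.hom.fst * C0.scalar u.inv.fst = 1 := by
    have h := congrArg (fun f => C0.scalar (CFP.Hom.fst f)) u.inv_hom_id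
    change C0.scalar (u.inv.fst ≫ u.hom.fst) = C0.scalar (𝟙 X.fst) at h
    rw [C0.scalar_comp', C0.scalar_id', hbase', hdeg, PNat.one_coe, pow_one] at h
    change D0.Hom.act (𝟙 X.fst.base) (C0.scalar u.hom.fst) * C0.scalar u.inv.fst = 1 at h
    unfold D0.Hom.act at h
    rwa [D0.twists_id, D0.galAct_false] at h
  have hnorm : ‖((C0.scalar u.hom.fst : ℂˣ) : ℂ)‖ * ‖((C0.scalar u.inv.fst : ℂˣ) : ℂ)‖ = 1 := by
    rw [← norm_mul, ← Units.val_mul, hprod, Units.val_one, norm_one]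
  refine le_antisymm h1 ?_
  by_contra hlt
  rw [not_le] at hlt
  have : ‖((C0.scalar u.hom.fst : ℂˣ) : ℂ)‖ * ‖((C0.scalar u.inv.fst : ℂˣ) : ℂ)‖ < 1 * 1 :=
    mul_lt_mul' hlt.le (lt_of_le_of_ne h2 (fun h => by
      rw [h, mul_one] at hnorm; exact absurd hnorm (ne_of_lt hlt))) (norm_nonneg _) one_pos
  rw [hnorm, mul_one] at this
  exact lt_irrefl _ this

/-- An element of `O^×(X)` IS `unitAutOver` of its scalar. [cite: MochizukiFrdII2008, Thm 3.6 (v) p.37] -/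
theorem eq_unitAutOver_of_mem (X : C π) (hX : X.fst.IsNaivelyIsotropic) (hc : X.fst.IsComplexObj)
    (u : Aut X) (hu : u ∈ PreFrobenioid.unitsSubgroup (C.toElem π) X) :
    u = unitAutOver π X hX hc (C0.scalar u.hom.fst)
      (norm_scalar_eq_one_of_mem_unitsSubgroup π X hX u hu) := by
  obtain ⟨hb, hd⟩ := hu
  have hsnd : u.hom.snd = 𝟙 X.snd := hb
  have hdeg : C0.degFr u.hom.fst = 1 := hd
  have hbase : C0.Base u.hom.fst = 𝟙 X.fst.base := by
    have hw := u.hom.w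
    rw [hsnd, CategoryTheory.Functor.map_id, Category.comp_id] at hw
    exact (cancel_mono X.iso.hom).mp (hw.trans (Category.id_comp _).symm)
  apply Iso.ext
  exact CFP.hom_ext (C0.hom_ext hbase hdeg rfl) hsnd

/-- `S¹ → O^×(X)`, `z ↦ ((id, 1, z), id)`, as a homomorphism into the subgroup `O^×(X)`.
[cite: MochizukiFrdII2008, Thm 3.6 (v) p.37] -/
noncomputable def circleToUnits (X : C π) (hX : X.fst.IsNaivelyIsotropic) (hc : X.fst.IsComplexObj) :
    Circle →* PreFrobenioid.unitsSubgroup (C.toElem π) X :=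
  (circleToAut π X hX hc).codRestrict (PreFrobenioid.unitsSubgroup (C.toElem π) X)
    (fun _ => unitAutOver_mem π X hX hc _ _)

/-- `circleToUnits` is bijective (every element of `O^×(X)` is `((id, 1, c), id)` with `|c| = 1`).
[cite: MochizukiFrdII2008, Thm 3.6 (v) p.37] -/
theorem circleToUnits_bijective (X : C π) (hX : X.fst.IsNaivelyIsotropic) (hc : X.fst.IsComplexObj) :
    Function.Bijective (circleToUnits π X hX hc) := by
  refine ⟨?_, ?_⟩
  · intro z w h
    have h' := congrArg (fun v : PreFrobenioid.unitsSubgroup (C.toElem π) X =>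
      C0.scalar (v : Aut X).hom.fst) h
    change Circle.toUnits z = Circle.toUnits w at h'
    exact Circle.ext (by
      have := congrArg (fun c : ℂˣ => (c : ℂ)) h'
      simpa [Circle.toUnits_apply] using this)
  · rintro ⟨u, hu⟩
    have hn := norm_scalar_eq_one_of_mem_unitsSubgroup π X hX u hu
    refine ⟨⟨((C0.scalar u.hom.fst : ℂˣ) : ℂ), mem_sphere_zero_iff_norm.mpr hn⟩, ?_⟩
    apply Subtype.ext
    change unitAutOver π X hX hc _ _ = u
    refine Eq.trans ?_ (eq_unitAutOver_of_mem π X hX hc u hu).symm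
    congr 1
    exact Units.ext (by rw [Circle.toUnits_apply, Units.val_mk0])

/-- The group isomorphism `S¹ ≅ O^×(X)` for a complex naively isotropic `X ∈ Ob(C)`.
[cite: MochizukiFrdII2008, Thm 3.6 (v) p.37] -/
noncomputable def circleEquivUnits (X : C π) (hX : X.fst.IsNaivelyIsotropic) (hc : X.fst.IsComplexObj) :
    Circle ≃* PreFrobenioid.unitsSubgroup (C.toElem π) X :=
  MulEquiv.ofBijective (circleToUnits π X hX hc) (circleToUnits_bijective π X hX hc)

/-- The underlying automorphism of `circleEquivUnits z` is `((id, 1, z), id)`.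
[cite: MochizukiFrdII2008, Thm 3.6 (v) p.37] -/
theorem circleEquivUnits_apply (X : C π) (hX : X.fst.IsNaivelyIsotropic) (hc : X.fst.IsComplexObj)
    (z : Circle) : ((circleEquivUnits π X hX hc z : PreFrobenioid.unitsSubgroup (C.toElem π) X) : Aut X) =
      unitAutOver π X hX hc (Circle.toUnits z) (norm_coe_circle_toUnits z) := rfl

/-- **Theorem 3.6 (v), "`O^×(A) ≅ S¹` for `Λ = ℤ` and `A` complex isotropic", for `C = C^ℤ`** (PROVED,
over any base `π : D → D₀`, base comparison `π ⋙ D0.toArchBase`). [cite: MochizukiFrdII2008, Thm 3.6 (v) p.37] -/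
theorem thm36v_isoCircle_C : Thm36v_isoCircle (π ⋙ D0.toArchBase) (C.toElem π) MonoidType.Z := by
  intro _ X hXc hXi
  have hX : X.fst.IsNaivelyIsotropic := isNaivelyIsotropic_fst_of_isIsotropic π X hXi
  have hπ : (π.obj X.snd).IsComplex := (D0.isComplex_toArchBase_iff _).mp hXc
  have hc : X.fst.IsComplexObj := D0.isComplex_of_hom X.iso.hom hπ
  exact ⟨(circleEquivUnits π X hX hc).symm⟩

end ArchFrd

end Literature.AlgebraicGeometry.Frobenioids
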